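import Summits.ResolutionOfSingularities.ResolutionOfSingularities.Theorems.WallLaw
import HarnessLib

/-!
# WallLaw2 — decomp-res node «WallCut» (lens-3 g21, critic row 158), tree file 2/5 of the node

Content VERBATIM from the decomp-res lens-3 g21 node `HOME/decomp-res-lens-3/g21/WallCut.lean` (pin 1e528a76 =
`parts/…` of HOME/decomp-res-lens-3/g21, 2 135 l; HOME = run/shared/lean/pub/decomp-res; lens imports = tree
`MaxContactCutFreezeCut` +
`StallVertexStraightClasses` only; rc 0 · 0 sorry): its NEW PART ONLY, §W1–§W4 (l. 1330–2120) — the carried block l.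
65–1328 (= g20
`ExtinctionCut` c917c20b l. 48–1308, code VERBATIM) is ALREADY in the tree as `FreezeCutDead` · `FreezeCutDead2` ·
`FreezeCutDeadClasses` ·
`MaxContactCutFreezeCutDead` · `ExtinctionCutToric` · `ExtinctionCutToric2` · `ExtinctionCutPort` ·
`MaxContactCutExtinctionCut` and is imported, not
repeated.  Critic: CRITIC-LEDGER row 158 (2026-08-31T00:37:25Z): 0 · 0 — BOOKED with CONVERSION RESERVED («true
kernel content, land as support»:
THE WALL LAW pins the multiplicities, THE POLLUTION LAW kills the cleaning deficiency, the closing step is the ONE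
port at generality δ).  Landing
orders INBOX :569 (lens-3 g21 landing note) and :577 (critic): `--kind proof --supports stmt-ResolutionOfSingularities-31770`
(`MaxContactCut.DefectWalksDeep`); files of the node, in import order: `WallLaw` / `WallLaw2` (§W1, kernel,
namespace `…Theorems.WallCut`, over the
in-cone `FreezeCutDead2` + the toric kernel `ExtinctionCutToric2`) · `PollutionLaw` (§W2, model level, cone-free) ·
`WallCutClasses` (§W3 the ONE typed
port `BalancedWallPort` with `kollarWallPort_of_balancedWallPort`, and the three §W4 classes; cone-free so that the
route file can cite the port as an
item) · `MaxContactCutWallCut` (§W4 kernels and EXACT iff's at 31770, Theses cone; §M `closes` = tree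
`MaxContactCutExponentLadder.closes` verbatim is
omitted, as in `MaxContactCutFreezeCut`).  Aside bookkeeping (rows 156 / 158, INBOX :552 / :577): on the lens-3
column ONE typed PORT item
`WallCut.BalancedWallPort` (g20's `ExtinctionCut.KollarWallPort` is DERIVED from it) and ONE live aside
`FreezeCut.NoSmallDeadStrictHighSkewJointTailsDeep`
(home `FreezeCutDeadClasses`; mod-port reading LOSSY ∧ WILD-BALANCED, `smallDeadStrict_iff_lossy_wild_of_port`);
decided-mod-port cells are not filed.

## This file

§W1 continued (second part): see `WallLaw`.  Imports `WallLaw`.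

[WRITER NOTE (decomp-res writer g9): file split only (tree files ≤ 400 lines); namespaces, sections, section
variables and every declaration
exactly as in the lens (the lens's global opens are replayed per file; cone-free files carry the opens of
`FreezeCutClasses.lean`).]

(Sources: Kollar2007 (Lectures on Resolution of Singularities: Thm 1.93, Def 2.56, Rem 2.57, Claim 2.59.1, (2.59.2),
Claim 2.59.4) [corpus:book:kollar2007-lectures-resolution-singularities pp. 54, 92–94]; ZariskiSamuel1960 vol. II
ch. VII §1 Thm 5; CossartJannsenSaito2009 (arXiv:0905.2191 §2); Hauser2010Kangaroo (arXiv:0811.4151); Moh1987;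
CossartPiltant2008 §2.)
-/

noncomputable section

open MvPolynomial Finset
open Literature.AlgebraicGeometry.Resolution
open Literature.AlgebraicGeometry.Resolution.Hauser2010
open Literature.AlgebraicGeometry.Resolution.PointBlowup
open Summit.ResolutionOfSingularities.ResolutionOfSingularities.Theses
open Summit.ResolutionOfSingularities.ResolutionOfSingularities.Theorems.TightDefectClasses
open Summit.ResolutionOfSingularities.ResolutionOfSingularities.Theorems.TightDefectStrongWalks
open Summit.ResolutionOfSingularities.ResolutionOfSingularities.Theorems.ItineraryCutClasses
open Summit.ResolutionOfSingularities.ResolutionOfSingularities.Theorems.BoundaryLedger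
open Summit.ResolutionOfSingularities.ResolutionOfSingularities.Theorems.ProximityCut
open Summit.ResolutionOfSingularities.ResolutionOfSingularities.Theorems.ConeCutAxisLaw
open Literature.AlgebraicGeometry.Resolution.WeightedBlowup
open Literature.Barriers.ResolutionOfSingularities
open Summit.ResolutionOfSingularities.ResolutionOfSingularities.Theorems.FloorCut
open Summit.ResolutionOfSingularities.ResolutionOfSingularities.Theorems.ConeCut
open Summit.ResolutionOfSingularities.ResolutionOfSingularities.Theorems.ExitLaw (fin3_cases eq_of_le_of_degree_le)
open Summit.ResolutionOfSingularities.ResolutionOfSingularities.Theorems.ShadeCut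
open Summit.ResolutionOfSingularities.ResolutionOfSingularities.Theorems.TightCut
open Summit.ResolutionOfSingularities.ResolutionOfSingularities.Theorems.HoleCut

namespace Summit.ResolutionOfSingularities.ResolutionOfSingularities.Theorems.WallCut

section WallLaw

variable {K : Type} [Field K] [DecidableEq K] {q : ℕ} {s₀ : State (Fin 3) K}
variable (W : ForcedWalk q s₀)
variable {W} {N n : ℕ}

/-- THE FRAME IS A §1-ORBIT: `frame (k+1) = step (frameWord k) (frame k)`. [new] [folklore] -/
theorem frame_step (hroot : IsRoot q s₀) (h : TailShade W N n)
    (hsz : ∀ t, N ≤ t → (∀ y, (W.st t).r y + 1 ≤ n) ∧ ∃ x, (W.st t).r x = 0)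
    (h2 : ∀ t, N ≤ t → ∃ y, y ≠ W.j t ∧ (W.st (t + 1)).r y ≠ 0) (k : ℕ) :
    frame W N n (k + 1) = ExtinctionCut.step (frameWord W N k) (frame W N n k) := by
  obtain ⟨hν, hκ1, hκ2⟩ := frame_succ hroot h hsz h2 (N + k) (by omega)
  rw [show N + k + 1 = N + (k + 1) from rfl] at hν hκ1 hκ2
  have hνZ : (newest W (N + (k + 1)) : ℤ) - ((q : ℤ) - n) =
      ((newest W (N + k) : ℤ) - ((q : ℤ) - n)) + ((keptMass W (N + k) : ℤ) - ((q : ℤ) - n)) := by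
    have := congrArg (fun m : ℕ => (m : ℤ)) hν
    push_cast at this
    linarith
  unfold frame frameWord
  by_cases hs : StaysOnNewest W (N + k)
  · have hκZ : (keptMass W (N + (k + 1)) : ℤ) = newest W (N + k) := by exact_mod_cast hκ1 hs
    rw [repParity_succ_of_stays hs]
    cases repParity W N k <;>
      simp only [Bool.not_true, Bool.not_false, if_true, if_false, Bool.false_eq_true, ExtinctionCut.step,
        Prod.mk.injEq] <;> constructor <;> linarith
  · have hκZ : (keptMass W (N + (k + 1)) : ℤ) = keptMass W (N + k) := by exact_mod_cast hκ2 hs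
    rw [repParity_succ_of_not_stays hs]
    cases repParity W N k <;>
      simp only [Bool.not_true, Bool.not_false, if_true, if_false, Bool.false_eq_true, ExtinctionCut.step,
        Prod.mk.injEq] <;> constructor <;> linarith

/-- `frame_eq_orbit`: Auxiliary step of this node's calculus, VERBATIM from the lens file (see the module
docstring); the statement is its type. [folklore] -/
theorem frame_eq_orbit (hroot : IsRoot q s₀) (h : TailShade W N n)
    (hsz : ∀ t, N ≤ t → (∀ y, (W.st t).r y + 1 ≤ n) ∧ ∃ x, (W.st t).r x = 0)
    (h2 : ∀ t, N ≤ t → ∃ y, y ≠ W.j t ∧ (W.st (t + 1)).r y ≠ 0) (k : ℕ) :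
    frame W N n k = ExtinctionCut.orbit (frameWord W N) (frame W N n 0) k := by
  induction k with
  | zero => rfl
  | succ k ih => rw [ExtinctionCut.orbit_succ, ← ih, frame_step hroot h hsz h2 k]

/-- **THE WALL LAW.**  On a shade-`n` tail with positive excess all of whose stages are small and carry a zero, if no
move from `N` on is a total loss and proximity repeats recur, then EVERY stage `t + 1`, `t ≥ N`, is δ-balanced:
`D_{t+1} + 2n = 2q` and `r_{t+1}` is a permutation of `(0, q − n, q − n)`. [new; KERNEL] [folklore] -/
theorem balanced_of_twoWalls (hroot : IsRoot q s₀) (h : TailShade W N n)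
    (hsz : ∀ t, N ≤ t → (∀ y, (W.st t).r y + 1 ≤ n) ∧ ∃ x, (W.st t).r x = 0)
    (h2 : ∀ t, N ≤ t → ∃ y, y ≠ W.j t ∧ (W.st (t + 1)).r y ≠ 0)
    (hrep : ∀ M, ∃ t, M ≤ t ∧ StaysOnNewest W t) :
    ∀ t, N ≤ t → (W.st (t + 1)).r.degree + 2 * n = 2 * q ∧
      ∃ x, (W.st (t + 1)).r x = 0 ∧ ∀ y, y ≠ x → (W.st (t + 1)).r y + n = q := by
  -- the word switches at every repeat, hence takes both letters beyond every bound
  have hswitch : ∀ M, ∃ k, M ≤ k ∧ frameWord W N (k + 1) ≠ frameWord W N k := by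
    intro M
    obtain ⟨t, ht, hst⟩ := hrep (N + (M + 1))
    refine ⟨t - N - 1, by omega, frameWord_switch ?_⟩
    rwa [show N + (t - N - 1 + 1) = t by omega]
  obtain ⟨hU, hV⟩ := ExtinctionCut.both_letters_of_switches (frameWord W N) hswitch
  -- bounds: the frame and its negative lie in the box `[-(q+n), ∞)²` with sums `≥ -(q+n)` along the orbit
  have hbd : ∀ k, -((q + n : ℕ) : ℤ) ≤ (frame W N n k).1 ∧ -((q + n : ℕ) : ℤ) ≤ (frame W N n k).2 ∧
      -((q + n : ℕ) : ℤ) ≤ (frame W N n k).1 + (frame W N n k).2 ∧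
      -((q + n : ℕ) : ℤ) ≤ (-(frame W N n k)).1 ∧ -((q + n : ℕ) : ℤ) ≤ (-(frame W N n k)).2 ∧
      -((q + n : ℕ) : ℤ) ≤ (-(frame W N n k)).1 + (-(frame W N n k)).2 := by
    intro k
    obtain ⟨hn1, hnq, k', -, -, hk1, hkn, hnn, hdeg, -⟩ := two_walls hroot h hsz h2 (N + k) (by omega)
    obtain ⟨hw1, hw2⟩ := h.degree_window hroot (N + k + 1) (by omega)
    obtain ⟨o, -, -, ho2, hod⟩ := h.order hroot (N + k) (by omega)
    unfold frame
    cases repParity W N k <;>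
      simp only [if_true, if_false, Bool.false_eq_true, Prod.fst_neg, Prod.snd_neg] <;> push_cast <;> omega
  -- extinction of the frame orbit and of its negative
  obtain ⟨tU, -, htU⟩ := hU 0
  obtain ⟨tV, -, htV⟩ := hV 0
  obtain ⟨T, hT⟩ : ∃ T, max tU tV + (q + n) + 1 ≤ T := ⟨_, le_rfl⟩
  have horb := frame_eq_orbit hroot h hsz h2 (N := N) (n := n)
  have hplus : ExtinctionCut.InQuad (frame W N n T) := by
    rw [horb T]
    exact ExtinctionCut.extinction (n := q + n) (fun k => by rw [← horb k]; exact (hbd k).2.2.1) hU hV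
      ⟨(hbd 0).1, (hbd 0).2.1⟩ htU htV T hT
  have hminus : ExtinctionCut.InQuad (-(frame W N n T)) := by
    rw [horb T, ← toric_orbit_neg]
    refine ExtinctionCut.extinction (n := q + n) (fun k => ?_) hU hV ⟨(hbd 0).2.2.2.1, (hbd 0).2.2.2.2.1⟩ htU htV
      T hT
    rw [toric_orbit_neg, ← horb k]
    exact (hbd k).2.2.2.2.2
  have hT0 : frame W N n T = 0 := eq_zero_of_inQuad_neg hplus hminus
  -- the frame vanishes identically: `(0,0)` has no other pre-image and no other image
  have hiff : ∀ k, frame W N n (k + 1) = 0 ↔ frame W N n k = 0 := by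
    intro k
    rw [frame_step hroot h hsz h2 k]
    exact ⟨toric_step_eq_zero, fun h0 => by rw [h0, toric_step_zero]⟩
  have hdown : ∀ d k, k + d = T → frame W N n k = 0 := by
    intro d
    induction d with
    | zero => intro k hk; rw [Nat.add_zero] at hk; rw [hk]; exact hT0
    | succ d ih => intro k hk; exact (hiff k).1 (ih (k + 1) (by omega))
  have hup : ∀ d, frame W N n (T + d) = 0 := by
    intro d
    induction d with
    | zero => exact hT0
    | succ d ih => exact (hiff (T + d)).2 ih
  have hall : ∀ k, frame W N n k = 0 := by
    intro k
    rcases Nat.lt_or_ge T k with hk | hk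
    · obtain ⟨d, rfl⟩ : ∃ d, k = T + d := ⟨k - T, by omega⟩
      exact hup d
    · exact hdown (T - k) k (by omega)
  -- read off the multiplicities
  intro t ht
  obtain ⟨k, rfl⟩ : ∃ k, t = N + k := ⟨t - N, by omega⟩
  obtain ⟨hn1, hnq, k', hk'j, hrk', hk1, hkn, hnn, hdeg, hzero⟩ := two_walls hroot h hsz h2 (N + k) (by omega)
  have hfr := hall k
  have hνκ : (newest W (N + k) : ℤ) - ((q : ℤ) - n) = 0 ∧ (keptMass W (N + k) : ℤ) - ((q : ℤ) - n) = 0 := by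
    unfold frame at hfr
    by_cases hp : repParity W N k = true
    · rw [if_pos hp, Prod.mk_eq_zero] at hfr; exact ⟨hfr.2, hfr.1⟩
    · rw [if_neg hp, Prod.mk_eq_zero] at hfr; exact hfr
  obtain ⟨h1, h2'⟩ := hνκ
  have hν : newest W (N + k) + n = q := by omega
  have hκ : keptMass W (N + k) + n = q := by omega
  obtain ⟨x, hxj, hxk⟩ := exists_third (hk'j.symm)
  refine ⟨by omega, x, hzero x hxj hxk, fun y hy => ?_⟩
  rcases fin3_cases hk'j.symm hxj hxk y with rfl | rfl | rfl
  · exact hν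
  · rw [hrk']; exact hκ
  · exact absurd rfl hy

/-- LEDGER OF A TOTAL LOSS: a move after which only the newest wall survives needs `D_t + 2n ≥ 2q + 1`
(`D_{t+1} = D_t + n − q` and the order window at `t + 1`). [new] [folklore] -/
theorem degree_of_totalLoss (hroot : IsRoot q s₀) (h : TailShade W N n) (t : ℕ) (ht : N ≤ t)
    (hloss : ∀ y, y ≠ W.j t → (W.st (t + 1)).r y = 0) : 2 * q + 1 ≤ (W.st t).r.degree + 2 * n := by
  obtain ⟨hS1, -, hkeep⟩ := h.step hroot t ht
  obtain ⟨hw, -⟩ := h.degree_window hroot (t + 1) (by omega)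
  have hk0 : kept W t = 0 := by
    ext y
    by_cases hy : y = W.j t
    · rw [hy]; exact kept_chart W t
    · rw [← hkeep y hy, hloss y hy]; rfl
  rw [hk0, map_zero] at hS1
  omega

/-- A small stage with a zero has `D_t + 2 ≤ 2n`. [new] [folklore] -/
theorem degree_le_of_smallZero {t : ℕ} (hsmall : ∀ y, (W.st t).r y + 1 ≤ n) {x : Fin 3}
    (hx : (W.st t).r x = 0) : (W.st t).r.degree + 2 ≤ 2 * n := by
  have hx1 : x ≠ x + 1 := by
    intro h; have := congrArg Fin.val h; simp [Fin.val_add] at this; omega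
  obtain ⟨k, hkx, hkx1⟩ := exists_third hx1
  rw [degree_eq_three (W.st t).r hx1 hkx hkx1, hx]
  have h1 := hsmall (x + 1)
  have h2 := hsmall k
  omega

/-- … so on the BOUNDARY LINE `q + 1 = 2n` a small stage with a zero admits NO total loss: there THE WALL LAW needs
no «no total loss» hypothesis and contains g19's D7 (`TailShade.balanced_of_skew`). [new] [folklore] -/
theorem twoWalls_of_boundary (hroot : IsRoot q s₀) (h : TailShade W N n) (hq : q + 1 = 2 * n)
    (hsz : ∀ t, N ≤ t → (∀ y, (W.st t).r y + 1 ≤ n) ∧ ∃ x, (W.st t).r x = 0) (t : ℕ) (ht : N ≤ t) :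
    ∃ y, y ≠ W.j t ∧ (W.st (t + 1)).r y ≠ 0 := by
  by_contra hne
  push Not at hne
  have hD := degree_of_totalLoss hroot h t ht hne
  obtain ⟨hsmall, x, hx⟩ := hsz t ht
  have := degree_le_of_smallZero (W := W) hsmall hx
  omega

/-- THE WALL LAW ON THE BOUNDARY LINE (= g19's D7 under D4's output, now a corollary). [new] [folklore] -/
theorem balanced_of_smallZero_boundary (hroot : IsRoot q s₀) (h : TailShade W N n) (hq : q + 1 = 2 * n)
    (hsz : ∀ t, N ≤ t → (∀ y, (W.st t).r y + 1 ≤ n) ∧ ∃ x, (W.st t).r x = 0)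
    (hrep : ∀ M, ∃ t, M ≤ t ∧ StaysOnNewest W t) :
    ∀ t, N ≤ t → (W.st (t + 1)).r.degree + 2 * n = 2 * q ∧
      ∃ x, (W.st (t + 1)).r x = 0 ∧ ∀ y, y ≠ x → (W.st (t + 1)).r y + n = q :=
  balanced_of_twoWalls hroot h hsz (twoWalls_of_boundary hroot h hq hsz) hrep

end WallLaw

end Summit.ResolutionOfSingularities.ResolutionOfSingularities.Theorems.WallCut
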